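import Summits.SmoothPoincare4.SmoothPoincare4.Theorems.SullivanDualRelativeSullivanDuality
import Summits.SmoothPoincare4.SmoothPoincare4.Theorems.SullivanDualClosedModelExtension
import Literature.Geometry.Symplectic.CompatibleAlmostComplexStructureExists
import Literature.Geometry.Symplectic.TamingWitness

/-!
# SmoothPoincare4 / SullivanDual — `Target` ⟺ route SymplecticCap's thesis (item 0518)

Crux `stmt-SmoothPoincare4-7823` (`Theses.SullivanDual.Target`), line `Sketch`, skeleton v4
(continuation lead c1). We prove, UNCONDITIONALLY and POINTWISE in `(Σ, p)`, that the matrix of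
`Target` at `(Σ, p)` — some smooth `J` with `J² = -1` on `Σ ∖ p` has no taming witness at any
small radius — is equivalent to the matrix of route SymplecticCap's crux `SympcapThesisV2`
(`stmt-SmoothPoincare4-0518`) at `(Σ, p)` — some smooth closed nondegenerate `2`-form on `Σ ∖ p`
is standard (`= ι*ω₀` through the chart at `p`) on a punctured chart-ball:

* `targetAt_of_isSymplecticStandardNearPoint` (⇐): a form `sf` with
  `IsSymplecticStandardNearPoint p ε sf` tames the `sf`-compatible smooth almost complex
  structure `J` of McDuff–Salamon Prop. 4.1.1 (i) (the tree's
  `exists_almostComplexStructure_isCompatibleWith`, unbundled to the crux's `inTangentCoordinates`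
  clause by `contMDiffAt_hom_bundle`), and a smooth CLOSED form STANDARD on the `ε`-ball taming
  `J` kills every taming witness at every radius `ε' ≤ ε` in two lines: (W3) gives `T sf ≤ 0`,
  (W1) gives `0 < T sf`. No standardness of `J` near `p` and no collar analysis is needed.
* `isSymplecticStandardNearPoint_of_targetAt` (⇒): the first half of the route's deciding
  theorem, over the CLOSED support items `ClosedModelExtension` (7829) and
  `RelativeSullivanDuality` (7827, Hahn–Banach).

Hence `target_iff_sympcapThesisV2 : Target ↔ ∀ Σ p, ∃ ε sf, IsSymplecticStandardNearPoint p ε sf`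
(the right-hand side is VERBATIM item 0518): the two routes' cruxes are one statement, with no
appeal to Gromov's recognition theorem in either direction.

API for the witness cruxes (7824–7826): `noWitness_iff_exists_isSymplecticStandardNearPoint_tamesOffBall`
(relative Sullivan duality as an `↔` at a fixed radius) and `exists_radius_noWitness_iff` (at all
radii below the `ClosedModelExtension` radius).
-/

noncomputable section

-- the registered namespace `Summit.SmoothPoincare4.SmoothPoincare4.Theorems` repeats a component
set_option linter.dupNamespace false

open scoped Manifold ContDiff Topology
open Set Filter Metric
open Literature.Geometry.Kaehler Literature.Geometry.Symplectic Literature.Topology.FourManifolds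

namespace Summit.SmoothPoincare4.SmoothPoincare4.Theorems

namespace SullivanDual

/-! ### Closed standard taming kills witnesses (pure form) -/

section Kill

variable {M : Type*} [TopologicalSpace M] [ChartedSpace (EuclideanSpace ℝ (Fin 4)) M] [T1Space M]

/-- **Closed standard taming kills witnesses.** If a smooth closed `2`-form `sf` on `M ∖ p` is
standard on the punctured `ε`-chart-ball and tames `J` off it, then `J` has no taming witness at
radius `ε`: a witness `T` would give `T sf ≤ 0` by (W3) and `0 < T sf` by (W1)
(Sullivan's "transversal closed form excludes structure cycles", relative form). [folklore] -/
theorem noWitness_of_closed_standard_tamesOffBall (p : M) {ε : ℝ}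
    (J : ∀ x : punctured p, TangentSpace (𝓡 4) x →L[ℝ] TangentSpace (𝓡 4) x)
    {sf : MForm (𝓡 4) (punctured p) ℝ 2} (hs : IsSmoothForm sf) (hc : IsClosedForm sf)
    (hstd : IsStandardOnBall p ε sf) (ht : TamesOffBall p ε J sf) : NoWitness p ε J :=
  fun _ hT => (hT.nonpos_of_standard hs hc hstd).not_gt (hT.pos_of_tames hs ht)

/-- **Closed standard taming kills witnesses at every smaller radius.** If `sf` is smooth,
closed, standard on the punctured `ε`-ball and tames `J` EVERYWHERE, then `J` has no taming
witness at any radius `ε' ≤ ε`. [folklore] -/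
theorem noWitness_of_closed_standard_tames (p : M) {ε ε' : ℝ} (hle : ε' ≤ ε)
    (J : ∀ x : punctured p, TangentSpace (𝓡 4) x →L[ℝ] TangentSpace (𝓡 4) x)
    {sf : MForm (𝓡 4) (punctured p) ℝ 2} (hs : IsSmoothForm sf) (hc : IsClosedForm sf)
    (hstd : IsStandardOnBall p ε sf)
    (ht : ∀ (x : punctured p) (v : TangentSpace (𝓡 4) x), v ≠ 0 → 0 < sf x ![v, J x v]) :
    NoWitness p ε' J :=
  noWitness_of_closed_standard_tamesOffBall p J hs hc (hstd.anti hle) fun x _ v hv => ht x v hv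

end Kill

/-! ### A nondegenerate smooth `2`-form tames a smooth almost complex structure -/

section Tamed

variable {M : Type*} [TopologicalSpace M] [T2Space M] [SecondCountableTopology M]
  [ChartedSpace (EuclideanSpace ℝ (Fin 4)) M] [IsManifold (𝓡 4) ∞ M]

/-- **Tamed `J` from a nondegenerate form** (McDuff–Salamon 2017, Prop. 4.1.1 (i), in the shape
of the crux). On the punctured manifold `M ∖ p` of a Hausdorff second-countable smooth
4-manifold, every smooth, pointwise nondegenerate `2`-form `sf` tames some smooth almost complex
structure: there is `J` with `J² = -1`, smooth in the sense of the crux (`inTangentCoordinates`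
at every point), and `sf(v, Jv) > 0` for `v ≠ 0`. The `J` is the `sf`-compatible structure of
`exists_almostComplexStructure_isCompatibleWith` (σ-compactness of `M ∖ p`: an open subspace of
a locally compact second-countable space); its bundled `C^∞` section property is unbundled by
Mathlib's `contMDiffAt_hom_bundle`. [cite: McDuffSalamon2017, Prop. 4.1.1 (i)] -/
theorem exists_tamedJ_of_nondegenerate (p : M)
    (sf : MForm (𝓡 4) (punctured p) ℝ 2) (hs : IsSmoothForm sf)
    (hnd : ∀ (x : punctured p) (v : TangentSpace (𝓡 4) x), v ≠ 0 →
      ∃ w : TangentSpace (𝓡 4) x, sf x ![v, w] ≠ 0) :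
    ∃ J : ∀ x : punctured p, TangentSpace (𝓡 4) x →L[ℝ] TangentSpace (𝓡 4) x,
      (∀ (x : punctured p) (v : TangentSpace (𝓡 4) x), J x (J x v) = -v) ∧
      (∀ x₀ : punctured p, ContMDiffAt (𝓡 4)
        𝓘(ℝ, EuclideanSpace ℝ (Fin 4) →L[ℝ] EuclideanSpace ℝ (Fin 4)) ∞
        (inTangentCoordinates (𝓡 4) (𝓡 4) (id : punctured p → punctured p) id
          (fun x => J x) x₀) x₀) ∧
      ∀ (x : punctured p) (v : TangentSpace (𝓡 4) x), v ≠ 0 → 0 < sf x ![v, J x v] := by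
  haveI : LocallyCompactSpace M := Manifold.locallyCompact_of_finiteDimensional (I := 𝓡 4)
  haveI : LocallyCompactSpace (punctured p) := (punctured p).2.locallyCompactSpace
  obtain ⟨J, hJ⟩ := exists_almostComplexStructure_isCompatibleWith (I := 𝓡 4) sf hs hnd
  refine ⟨fun x => J x, fun x v => J.map_map' x v, fun x₀ => ?_, fun x v hv => hJ.isTamedBy x v hv⟩
  exact ((contMDiffAt_hom_bundle _).1 (J.contMDiff' x₀)).2

end Tamed

/-! ### `Target` at `(Σ, p)` ⟺ a symplectic form standard near `p` -/

/-- **(⇐) A symplectic form standard near `p` gives the matrix of `Target` at `(Σ, p)`.**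
If `sf` on `Σ ∖ p` satisfies `IsSymplecticStandardNearPoint p ε sf`, then some smooth `J` with
`J² = -1` on `Σ ∖ p` (the `sf`-compatible one) has, with `ε₁ := ε`, no taming witness at any
radius `0 < ε' ≤ ε₁` — VERBATIM the matrix of `Theses.SullivanDual.Target`. [folklore] -/
theorem targetAt_of_isSymplecticStandardNearPoint (S : HomotopySphere 4) (p : S.carrier)
    {ε : ℝ} {sf : MForm (𝓡 4) (punctured p) ℝ 2} (hsf : IsSymplecticStandardNearPoint p ε sf) :
    ∃ (J : ∀ x : punctured p, TangentSpace (𝓡 4) x →L[ℝ] TangentSpace (𝓡 4) x),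
      (∀ (x : punctured p) (v : TangentSpace (𝓡 4) x), J x (J x v) = -v) ∧
      (∀ x₀ : punctured p, ContMDiffAt (𝓡 4)
        𝓘(ℝ, EuclideanSpace ℝ (Fin 4) →L[ℝ] EuclideanSpace ℝ (Fin 4)) ∞
        (inTangentCoordinates (𝓡 4) (𝓡 4) (id : punctured p → punctured p) id
          (fun x => J x) x₀) x₀) ∧
      ∃ ε₁ : ℝ, 0 < ε₁ ∧ ∀ ε' : ℝ, 0 < ε' → ε' ≤ ε₁ → NoWitness p ε' J := by
  obtain ⟨J, hJ2, hJs, ht⟩ := exists_tamedJ_of_nondegenerate p sf hsf.isSmoothForm hsf.nondegenerate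
  refine ⟨J, hJ2, hJs, ε, hsf.pos, fun ε' _ hle => ?_⟩
  exact noWitness_of_closed_standard_tames p hle J hsf.isSmoothForm hsf.isClosedForm
    (fun x hx v w => hsf.eq_invertedStdForm hx v w) ht

/-- **(⇒) The matrix of `Target` at `(Σ, p)` gives a symplectic form standard near `p`.** If some
smooth `J` with `J² = -1` on `Σ ∖ p` has no taming witness at all radii `0 < ε ≤ ε₁`, then at
`ε := min ε₀ ε₁` (`ε₀` from the landed `ClosedModelExtension_proof`, so that some smooth closed
form is standard on `B_ε`) the landed `RelativeSullivanDuality_proof` (Hahn–Banach) yields `sf`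
with `IsSymplecticStandardNearPoint p ε sf` — the first half of the route's deciding theorem,
now unconditional. [folklore] -/
theorem isSymplecticStandardNearPoint_of_targetAt (S : HomotopySphere 4) (p : S.carrier)
    (h : ∃ (J : ∀ x : punctured p, TangentSpace (𝓡 4) x →L[ℝ] TangentSpace (𝓡 4) x),
      (∀ (x : punctured p) (v : TangentSpace (𝓡 4) x), J x (J x v) = -v) ∧
      (∀ x₀ : punctured p, ContMDiffAt (𝓡 4)
        𝓘(ℝ, EuclideanSpace ℝ (Fin 4) →L[ℝ] EuclideanSpace ℝ (Fin 4)) ∞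
        (inTangentCoordinates (𝓡 4) (𝓡 4) (id : punctured p → punctured p) id
          (fun x => J x) x₀) x₀) ∧
      ∃ ε₁ : ℝ, 0 < ε₁ ∧ ∀ ε' : ℝ, 0 < ε' → ε' ≤ ε₁ → NoWitness p ε' J) :
    ∃ (ε : ℝ) (sf : MForm (𝓡 4) (punctured p) ℝ 2), IsSymplecticStandardNearPoint p ε sf := by
  obtain ⟨J, hJ2, hJs, ε₁, hε₁, hNoW⟩ := h
  obtain ⟨ε₀, hε₀, α₀, hα₀s, hα₀c, hα₀m⟩ := ClosedModelExtension_proof S p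
  obtain ⟨sf, hsf, -⟩ := RelativeSullivanDuality_proof S p J (min ε₀ ε₁) (lt_min hε₀ hε₁) hJ2 hJs
    ⟨α₀, hα₀s, hα₀c, fun x hx v w =>
      hα₀m x ⟨hx.1, Metric.ball_subset_ball (min_le_left ε₀ ε₁) hx.2⟩ v w⟩
    (hNoW (min ε₀ ε₁) (lt_min hε₀ hε₁) (min_le_right ε₀ ε₁))
  exact ⟨min ε₀ ε₁, sf, hsf⟩

/-- **Pointwise equivalence.** At every `(Σ, p)`: some smooth `J` with `J² = -1` on `Σ ∖ p` has
no taming witness at all small radii iff some `2`-form on `Σ ∖ p` is symplectic and standard near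
`p` (`IsSymplecticStandardNearPoint`). [folklore] -/
theorem targetAt_iff_exists_isSymplecticStandardNearPoint (S : HomotopySphere 4) (p : S.carrier) :
    (∃ (J : ∀ x : punctured p, TangentSpace (𝓡 4) x →L[ℝ] TangentSpace (𝓡 4) x),
      (∀ (x : punctured p) (v : TangentSpace (𝓡 4) x), J x (J x v) = -v) ∧
      (∀ x₀ : punctured p, ContMDiffAt (𝓡 4)
        𝓘(ℝ, EuclideanSpace ℝ (Fin 4) →L[ℝ] EuclideanSpace ℝ (Fin 4)) ∞
        (inTangentCoordinates (𝓡 4) (𝓡 4) (id : punctured p → punctured p) id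
          (fun x => J x) x₀) x₀) ∧
      ∃ ε₁ : ℝ, 0 < ε₁ ∧ ∀ ε' : ℝ, 0 < ε' → ε' ≤ ε₁ → NoWitness p ε' J) ↔
    ∃ (ε : ℝ) (sf : MForm (𝓡 4) (punctured p) ℝ 2), IsSymplecticStandardNearPoint p ε sf :=
  ⟨isSymplecticStandardNearPoint_of_targetAt S p,
    fun ⟨_, _, hsf⟩ => targetAt_of_isSymplecticStandardNearPoint S p hsf⟩

/-! ### `Target` ⟺ `SympcapThesisV2` (item 0518, verbatim) -/

/-- **`Target` from route SymplecticCap's thesis** (`stmt-SmoothPoincare4-0518`, whose statement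
is VERBATIM the hypothesis): pointwise `targetAt_of_isSymplecticStandardNearPoint`; `NoWitness`
unfolds by `Iff.rfl` to the negated conjunction of `Target`. [folklore] -/
theorem target_of_sympcapThesisV2
    (h : ∀ (S : Literature.Topology.FourManifolds.HomotopySphere 4) (p : S.carrier),
      ∃ (ε : ℝ) (sf : Literature.Geometry.Kaehler.MForm (𝓡 4)
        (Literature.Geometry.Symplectic.punctured p) ℝ 2),
        Literature.Geometry.Symplectic.IsSymplecticStandardNearPoint p ε sf) :
    Summit.SmoothPoincare4.SmoothPoincare4.Theses.SullivanDual.Target := by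
  intro S p
  obtain ⟨ε, sf, hsf⟩ := h S p
  exact targetAt_of_isSymplecticStandardNearPoint S p hsf

/-- **Route SymplecticCap's thesis from `Target`** (unconditional: over the closed items 7829 and
7827 only): pointwise `isSymplecticStandardNearPoint_of_targetAt`. [folklore] -/
theorem sympcapThesisV2_of_target
    (h : Summit.SmoothPoincare4.SmoothPoincare4.Theses.SullivanDual.Target) :
    ∀ (S : Literature.Topology.FourManifolds.HomotopySphere 4) (p : S.carrier),
      ∃ (ε : ℝ) (sf : Literature.Geometry.Kaehler.MForm (𝓡 4)
        (Literature.Geometry.Symplectic.punctured p) ℝ 2),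
        Literature.Geometry.Symplectic.IsSymplecticStandardNearPoint p ε sf :=
  fun S p => isSymplecticStandardNearPoint_of_targetAt S p (h S p)

/-- **The cruxes of routes SullivanDual and SymplecticCap coincide**: `Target ↔ SympcapThesisV2`
(right-hand side verbatim `stmt-SmoothPoincare4-0518`), both directions unconditional — no appeal
to Gromov's recognition of `ℝ⁴`. [folklore] -/
theorem target_iff_sympcapThesisV2 :
    Summit.SmoothPoincare4.SmoothPoincare4.Theses.SullivanDual.Target ↔
      ∀ (S : Literature.Topology.FourManifolds.HomotopySphere 4) (p : S.carrier),
        ∃ (ε : ℝ) (sf : Literature.Geometry.Kaehler.MForm (𝓡 4)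
          (Literature.Geometry.Symplectic.punctured p) ℝ 2),
          Literature.Geometry.Symplectic.IsSymplecticStandardNearPoint p ε sf :=
  ⟨sympcapThesisV2_of_target, target_of_sympcapThesisV2⟩

/-! ### Relative Sullivan duality as an equivalence (API for the witness cruxes 7824–7826) -/

/-- **Relative Sullivan duality, both directions, at a fixed radius.** Let `J` be smooth with
`J² = -1` on `Σ ∖ p`, `0 < ε`, and suppose SOME smooth closed form is standard on the punctured
`ε`-ball. Then `J` has no taming witness at radius `ε` iff some `sf` with
`IsSymplecticStandardNearPoint p ε sf` tames `J` off the ball: (⇒) is the landed Hahn–Banach item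
`RelativeSullivanDuality_proof` (7827); (⇐) is the two-line kill
`noWitness_of_closed_standard_tamesOffBall`. Contrapositive reading for `WitnessCharge`: a
taming witness at radius `ε` exists iff NO closed form standard on `B_ε` tames `J` off `B_ε`.
[cite: Sullivan1976, Thm. I.7] -/
theorem noWitness_iff_exists_isSymplecticStandardNearPoint_tamesOffBall (S : HomotopySphere 4)
    (p : S.carrier) (J : ∀ x : punctured p, TangentSpace (𝓡 4) x →L[ℝ] TangentSpace (𝓡 4) x)
    {ε : ℝ} (hε : 0 < ε)
    (hJ2 : ∀ (x : punctured p) (v : TangentSpace (𝓡 4) x), J x (J x v) = -v)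
    (hJs : ∀ x₀ : punctured p, ContMDiffAt (𝓡 4)
      𝓘(ℝ, EuclideanSpace ℝ (Fin 4) →L[ℝ] EuclideanSpace ℝ (Fin 4)) ∞
      (inTangentCoordinates (𝓡 4) (𝓡 4) (id : punctured p → punctured p) id
        (fun x => J x) x₀) x₀)
    (hex : ∃ α₀ : MForm (𝓡 4) (punctured p) ℝ 2,
      IsSmoothForm α₀ ∧ IsClosedForm α₀ ∧ IsStandardOnBall p ε α₀) :
    NoWitness p ε J ↔
      ∃ sf : MForm (𝓡 4) (punctured p) ℝ 2,
        IsSymplecticStandardNearPoint p ε sf ∧ TamesOffBall p ε J sf :=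
  ⟨fun h => RelativeSullivanDuality_proof S p J ε hε hJ2 hJs hex h,
    fun ⟨_, hsf, ht⟩ => noWitness_of_closed_standard_tamesOffBall p J hsf.isSmoothForm
      hsf.isClosedForm (fun _ hx v w => hsf.eq_invertedStdForm hx v w) ht⟩

/-- **Relative Sullivan duality at all small radii.** For every `(Σ, p)` there is `ε₀ > 0` (the
radius of the landed `ClosedModelExtension_proof`, 7829) such that for every smooth `J` with
`J² = -1` on `Σ ∖ p` and every `0 < ε ≤ ε₀`: no taming witness at radius `ε` iff some symplectic
form standard on the `ε`-ball tames `J` off it. [cite: Sullivan1976, Thm. I.7] -/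
theorem exists_radius_noWitness_iff (S : HomotopySphere 4) (p : S.carrier) :
    ∃ ε₀ : ℝ, 0 < ε₀ ∧
      ∀ (J : ∀ x : punctured p, TangentSpace (𝓡 4) x →L[ℝ] TangentSpace (𝓡 4) x),
        (∀ (x : punctured p) (v : TangentSpace (𝓡 4) x), J x (J x v) = -v) →
        (∀ x₀ : punctured p, ContMDiffAt (𝓡 4)
          𝓘(ℝ, EuclideanSpace ℝ (Fin 4) →L[ℝ] EuclideanSpace ℝ (Fin 4)) ∞
          (inTangentCoordinates (𝓡 4) (𝓡 4) (id : punctured p → punctured p) id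
            (fun x => J x) x₀) x₀) →
        ∀ ε : ℝ, 0 < ε → ε ≤ ε₀ →
          (NoWitness p ε J ↔
            ∃ sf : MForm (𝓡 4) (punctured p) ℝ 2,
              IsSymplecticStandardNearPoint p ε sf ∧ TamesOffBall p ε J sf) := by
  obtain ⟨ε₀, hε₀, α₀, hα₀s, hα₀c, hα₀m⟩ := ClosedModelExtension_proof S p
  refine ⟨ε₀, hε₀, fun J hJ2 hJs ε hε hle => ?_⟩
  exact noWitness_iff_exists_isSymplecticStandardNearPoint_tamesOffBall S p J hε hJ2 hJs
    ⟨α₀, hα₀s, hα₀c, fun x hx v w => hα₀m x (hx.mono hle) v w⟩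

end SullivanDual

end Summit.SmoothPoincare4.SmoothPoincare4.Theorems

end
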